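import Mathlib
import HarnessLib
import Summits.QuantumFields.YangMills.Theses.FemtoCutoffLadder
import Summits.QuantumFields.YangMills.Theorems.FemtoTransferGapBounds
import Summits.QuantumFields.YangMills.Theorems.FemtoTransferGapLevelsPos

/-!
# FemtoCutoffLadder — glue of the small-field split of `OctaveStepDecay` (stmt-QuantumFields-25697)

`SmallFieldOctaveStep → LargeFieldInsensitivity → OctaveStepDecay` (route FemtoCutoffLadder, rev 12, split
of stmt-QuantumFields-24153 by seat ym-idea-1 g4, D-0145 LINE «small-field compression»): instantiate the
large-field insensitivity at the κ, σ of the compressed octave step, pass to the sub-tower of base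
L0ˢ·2^{L0ᴸ}, chain the three cross-multiplied inequalities, cancel the positive compressed top values and
bound the exponent by (C₁ + 2C₂)Λ²/L'^σ + D(1/β' − 1/β) (`Real.rpow_le_rpow`).  Pure real arithmetic. [folklore]
-/

namespace Summit.QuantumFields.YangMills.Theorems.FemtoCutoffLadder

open Summit.QuantumFields.YangMills.Theorems.FemtoTransferGap
open Summit.QuantumFields.YangMills.Theses.FemtoCutoffLadder

/-- **Glue of the small-field split** (item stmt-QuantumFields-25697):
`SmallFieldOctaveStep → LargeFieldInsensitivity → OctaveStepDecay`. [folklore] -/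
theorem smallFieldSplitGlue_proof : SmallFieldSplitGlue := by
  intro hA hB
  obtain ⟨C₁, σ, D, κ, lam₁, L₁, hL₁, hσ, hκ, hκ1, hlam₁, hC₁, hD, hA⟩ := hA
  obtain ⟨C₂, lam₂, L₂, hC₂, hlam₂, hB⟩ := hB κ σ hκ hκ1 hσ
  refine ⟨C₁ + 2 * C₂, σ, D, min lam₁ lam₂, L₁ * 2 ^ L₂, ?_, hσ, lt_min hlam₁ hlam₂, hD, ?_⟩
  · positivity
  intro lam hlam hle i L' _ L _ hL' hL β β' hW hW' hmatch
  have hle₁ : lam ≤ lam₁ := le_trans hle (min_le_left _ _)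
  have hle₂ : lam ≤ lam₂ := le_trans hle (min_le_right _ _)
  -- L' is the member of index L₂ + i of the A-tower, and L' ≥ 2^L₂ ≥ L₂
  have hL'A : L' = L₁ * 2 ^ (L₂ + i) := by rw [hL', pow_add, mul_assoc]
  have h2pow : 2 ^ L₂ ≤ L' := by
    rw [hL']
    calc 2 ^ L₂ ≤ L₁ * 2 ^ L₂ := Nat.le_mul_of_pos_left _ hL₁
      _ ≤ L₁ * 2 ^ L₂ * 2 ^ i := Nat.le_mul_of_pos_right _ (by positivity)
  have hL'ge : L₂ ≤ L' := le_trans (Nat.lt_two_pow_self).le h2pow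
  have hLge : L₂ ≤ L := by omega
  have hA1 := hA lam hlam hle₁ (L₂ + i) L' L hL'A hL β β' hW hW' hmatch
  obtain ⟨ht, hB1, -⟩ := hB lam hlam hle₂ L hLge β hW
  obtain ⟨ht', -, hB2⟩ := hB lam hlam hle₂ L' hL'ge β' hW'
  simp only [] at hA1 hB1 hB2 ht ht'
  -- names
  set S := secondValue su2Rep L β ^ L
  set T := topValue su2Rep L β ^ L
  set S' := secondValue su2Rep L' β' ^ L'
  set T' := topValue su2Rep L' β' ^ L'
  set P : (Literature.MathematicalPhysics.QuantumFieldTheory.GaugeConfig 3 L SU2 → ℝ) → Prop := fun ψ => ∀ U, (∃ p : Literature.MathematicalPhysics.QuantumFieldTheory.Plaquette 3 L, β ^ (κ - 1) < 2 - (su2Rep (Literature.MathematicalPhysics.QuantumFieldTheory.plaquetteHolonomy U p.1 p.2.1.1 p.2.1.2)).trace.re) → ψ U = 0 with hP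
  set P' : (Literature.MathematicalPhysics.QuantumFieldTheory.GaugeConfig 3 L' SU2 → ℝ) → Prop := fun ψ => ∀ U, (∃ p : Literature.MathematicalPhysics.QuantumFieldTheory.Plaquette 3 L', β' ^ (κ - 1) < 2 - (su2Rep (Literature.MathematicalPhysics.QuantumFieldTheory.plaquetteHolonomy U p.1 p.2.1.1 p.2.1.2)).trace.re) → ψ U = 0 with hP'
  set t := sSup (rayleighSet su2Rep L β P) ^ L
  set s := sInf {x : ℝ | ∃ φ : Literature.MathematicalPhysics.QuantumFieldTheory.GaugeConfig 3 L SU2 → ℝ, IsPhys φ ∧ x = sSup (rayleighSet su2Rep L β fun ψ => P ψ ∧ l2 ψ φ = 0)} ^ L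
  set t' := sSup (rayleighSet su2Rep L' β' P') ^ L'
  set s' := sInf {x : ℝ | ∃ φ : Literature.MathematicalPhysics.QuantumFieldTheory.GaugeConfig 3 L' SU2 → ℝ, IsPhys φ ∧ x = sSup (rayleighSet su2Rep L' β' fun ψ => P' ψ ∧ l2 ψ φ = 0)} ^ L'
  set E₁ := Real.exp (C₁ * luscherLambda β L ^ 2 / (L' : ℝ) ^ σ + D * (1 / β' - 1 / β))
  set E₂ := Real.exp (C₂ * luscherLambda β L ^ 2 / (L : ℝ) ^ σ)
  set E₃ := Real.exp (C₂ * luscherLambda β' L' ^ 2 / (L' : ℝ) ^ σ)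
  -- positivity
  have htL : 0 < t := pow_pos ht _
  have htL' : 0 < t' := pow_pos ht' _
  have hT : 0 ≤ T := pow_nonneg (topValue_su2Rep_pos _ _).le _
  have hT' : 0 ≤ T' := pow_nonneg (topValue_su2Rep_pos _ _).le _
  have hE₁ : 0 ≤ E₁ := (Real.exp_pos _).le
  have hE₂ : 0 ≤ E₂ := (Real.exp_pos _).le
  -- the division chain, cross-multiplied
  have key : S * T' * (t * t') ≤ E₂ * E₁ * E₃ * (S' * T) * (t * t') := by
    have c1 : S * T' * (t * t') ≤ E₂ * (s * T) * T' * t' := by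
      have := mul_le_mul_of_nonneg_right (mul_le_mul_of_nonneg_right hB1 hT') htL'.le
      calc S * T' * (t * t') = S * t * T' * t' := by ring
        _ ≤ _ := this
    have c2 : E₂ * (s * T) * T' * t' ≤ E₂ * T * T' * (E₁ * (s' * t)) := by
      have := mul_le_mul_of_nonneg_left hA1 (mul_nonneg (mul_nonneg hE₂ hT) hT')
      calc E₂ * (s * T) * T' * t' = E₂ * T * T' * (s * t') := by ring
        _ ≤ _ := this
    have c3 : E₂ * T * T' * (E₁ * (s' * t)) ≤ E₂ * E₁ * T * t * (E₃ * (S' * t')) := by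
      have := mul_le_mul_of_nonneg_left hB2 (mul_nonneg (mul_nonneg (mul_nonneg hE₂ hE₁) hT) htL.le)
      calc E₂ * T * T' * (E₁ * (s' * t)) = E₂ * E₁ * T * t * (s' * T') := by ring
        _ ≤ _ := this
    calc S * T' * (t * t') ≤ _ := c1
      _ ≤ _ := c2
      _ ≤ _ := c3
      _ = E₂ * E₁ * E₃ * (S' * T) * (t * t') := by ring
  have key' : S * T' ≤ E₂ * E₁ * E₃ * (S' * T) := le_of_mul_le_mul_right key (mul_pos htL htL')
  -- exponent bookkeeping: E₂ E₁ E₃ ≤ exp((C₁ + 2C₂) Λ² / L'^σ + D (1/β' − 1/β))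
  have hΛ : luscherLambda β' L' = luscherLambda β L := hmatch.symm
  have hL'pos : (0 : ℝ) < (L' : ℝ) := by exact_mod_cast Nat.pos_of_ne_zero (NeZero.ne L')
  have hL'1 : (1 : ℝ) ≤ (L' : ℝ) := by exact_mod_cast Nat.pos_of_ne_zero (NeZero.ne L')
  have hLL' : (L' : ℝ) ≤ (L : ℝ) := by exact_mod_cast (by omega : L' ≤ L)
  have hpowpos : 0 < (L' : ℝ) ^ σ := Real.rpow_pos_of_pos hL'pos σ
  have hpow_le : (L' : ℝ) ^ σ ≤ (L : ℝ) ^ σ := Real.rpow_le_rpow hL'pos.le hLL' hσ.le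
  have hΛ2 : 0 ≤ luscherLambda β L ^ 2 := sq_nonneg _
  have hfrac : C₂ * luscherLambda β L ^ 2 / (L : ℝ) ^ σ ≤ C₂ * luscherLambda β L ^ 2 / (L' : ℝ) ^ σ :=
    div_le_div_of_nonneg_left (mul_nonneg hC₂ hΛ2) hpowpos hpow_le
  have hexp : E₂ * E₁ * E₃ ≤ Real.exp ((C₁ + 2 * C₂) * luscherLambda β L ^ 2 / (L' : ℝ) ^ σ + D * (1 / β' - 1 / β)) := by
    have : E₂ * E₁ * E₃ = Real.exp (C₂ * luscherLambda β L ^ 2 / (L : ℝ) ^ σ + (C₁ * luscherLambda β L ^ 2 / (L' : ℝ) ^ σ + D * (1 / β' - 1 / β)) + C₂ * luscherLambda β L ^ 2 / (L' : ℝ) ^ σ) := by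
      simp only [E₁, E₂, E₃, hΛ, ← Real.exp_add]
    rw [this]
    apply Real.exp_le_exp.mpr
    have hsplit : (C₁ + 2 * C₂) * luscherLambda β L ^ 2 / (L' : ℝ) ^ σ = C₁ * luscherLambda β L ^ 2 / (L' : ℝ) ^ σ + C₂ * luscherLambda β L ^ 2 / (L' : ℝ) ^ σ + C₂ * luscherLambda β L ^ 2 / (L' : ℝ) ^ σ := by ring
    rw [hsplit]; linarith
  have hS'T : 0 ≤ S' * T := mul_nonneg (pow_nonneg (secondValue_su2Rep_pos (L := L') (by linarith [hW'.1])).le _) hT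
  calc S * T' ≤ E₂ * E₁ * E₃ * (S' * T) := key'
    _ ≤ _ := mul_le_mul_of_nonneg_right hexp hS'T


end Summit.QuantumFields.YangMills.Theorems.FemtoCutoffLadder
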